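import Mathlib

/-!
# T4CauchySum — the Cauchy sum of the uniqueness spine (cell `pub-balaban`, T4-DAG v0 node U6, row T4-U6.L; bookkeeping)

HONEST FRAMING (cell `pub-balaban`, T4-DAG v0 PAGE 1).  The cell's T4 target is the existence AND uniqueness of the
continuum limit of Bałaban's unit-scale averaged loop expectations on a finite torus — a constructive-QFT statement
strictly beyond ultraviolet stability ([Balaban1989LargeFieldII] Thm 1 p. 355); it is NOT the Yang–Mills mass gap and
NOT the Clay problem.  This module is the LAST, purely arithmetic node of that spine (node U6, "the Cauchy sum").  It
asserts NOTHING about Bałaban's renormalization-group objects: every `def … : Prop` below is a HYPOTHESIS SHAPE over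
abstract real sequences (a predicate, never used as a fact — the estimates that would instantiate the shapes are the
cell's located NEW estimates NE2–NE7, none of them in print), and every theorem is elementary real analysis (finite sums,
geometric series, `Real.log` / `Real.exp`, Cauchy sequences, one monotonicity-of-the-integral step).  Value = kernel
bookkeeping of an implication ⇐ named inputs; NOT summit progress.

Printed context (verbatim, page-cited; the manuscripts under audit are quoted for CONTEXT only — no disputed step of
theirs is used anywhere below).
* The template is C. King, Commun. Math. Phys. 102 (1986) 649–677 (the U(1) Higgs model, d = 2, 3), p. 656: "The
  following theorem is the core of this paper. Theorem 3.4. [the bound (3.9) on the difference of the effective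
  actions S^{(k)} and S^{(k+n)} generated from the lattices T_{ε_K} and T_{ε_{K+n}}] … We can now prove Theorem 2.1.",
  and p. 657: "Hence {Z^{ε_K}(T_{ε_K}, g, h)} is a Cauchy sequence and converges to a unique limit as K → ∞. The
  uniform bound in Theorem 2.1 is just the statement of ultra-violet stability." [King1986, Thm 3.4 p. 656; p. 657]
* Why d = 4 needs a different organisation of the same Cauchy sum — [Balaban1989LargeFieldI] p. 175, verbatim: "For
  d = 4 the bare coupling constant behaves asymptotically as (a + b log ε⁻¹)^{−1/2}, for ε → 0, with some positive
  constants a, b, hence the bound does not give any positive power of ε. It is still small for ε small, and it controls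
  a large number of steps, but this number is a small fraction of the total number of steps."  No ε^σ-smallness being
  available, the spine (cell T4-DAG v0 §1 D3) compares two infrared-matched runs (A: K steps from ε = L^{−K}; B: K + 1
  steps from ε/L) scale by scale, with GEOMETRIC η-rates θ^j for the discrepancies injected at scale j (nodes U1–U3;
  hypotheses, not in print), the printed IRRELEVANCE CONTRACTION transporting them to the last scale —
  [Balaban1988Convergent] Thm 2 p. 263, (2.43), verbatim: "Under the assumptions of Theorem 1 there exists a constant
  E_1 independent of j, k, Ω, {Ω_j}, {Λ_j}, T (but dependent on the other constants occurring in the formulation of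
  this theorem), such that | Σ_{z∈Λ_j^0∩Ω} [E^{(j)}(Λ_j, U_k, z) − E^{(j)}(Λ_j, 1, z)] − β_j(g_{j−1}) A(φ, U_k) |
  ≤ E_1 Σ_{n=j}^k (L^{j−n})^β |Γ_n ∩ Ω| , (2.43) for β < 1 … The constant E_1 depends on β also, and grows to ∞ if
  β → 1." (node U4 uses the same contraction for DIFFERENCES of the two runs' terms — a hypothesis here) — and a
  matching of the two runs' last-scale densities MODULO CONSTANTS (node U5; hypothesis, the hard new estimate NE7).
  Asymptotic freedom enters node U6 only as a polynomial factor (K+1)^c multiplying the geometric rates (node U2: the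
  product of one-step Lipschitz factors ∏_{i<K}(1 + a·g_i²) with Σ_{i<K} g_i² = O(log K)); §4 below is that arithmetic.

What is proved (all [folklore]; K = number of steps of run A, j = scale of injection, n = K − j = number of remaining
scales; the sum runs over `Finset.antidiagonal K`, so no truncated subtraction occurs).
§1 Hypothesis shapes: `GeomRate C θ s` (U1/U3-type: |s j| ≤ C θ^j); `InjectedRate C c θ inj` (U1+U2+U3 combined:
   0 ≤ inj K j ≤ C (K+1)^c θ^j for j ≤ K) with the closure rules used to merge the five sources (`of_geomRate`, `add`,
   `mono_rate`); the transported total `delta E ρ inj K = E · Σ_{j+n=K} inj K j · ρ^n` (U4 shape, ρ = L^{−β}); and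
   `MatchingModConstants vol l₀ δ Z` (U5 output at the level of the dressed partition functions K ↦ λ ↦ Z_K(λ):
   log Z_{K+1}(λ) − log Z_K(λ) = c_K + r_K(λ) with c_K independent of λ and |r_K(λ)| ≤ vol·δ_K on |λ| ≤ λ₀; in Lean
   the source strength λ is `t` and the radius λ₀ is `l₀`, `λ` being a reserved token).
§2 The sum: Σ_{j+n=K} θ^j ρ^n ≤ (K+1)·max(θ,ρ)^K; `delta E ρ inj K ≤ E·C·(K+1)^{c+1}·max(θ,ρ)^K`; summability of
   K ↦ (K+1)^k q^K for 0 ≤ q < 1; hence `Summable (delta E ρ inj)` when θ, ρ ∈ [0,1[.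
§3 Constants quotient out (cell D2): with `genFun Z K λ = log Z_K(λ) − log Z_K(0)`,
   |genFun Z (K+1) λ − genFun Z K λ| ≤ 2·vol·δ_K under `MatchingModConstants`; the pointwise-to-integral step
   (e^{c−r} f ≤ g ≤ e^{c+r} f a.e. ⇒ |log ∫g − log ∫f − c| ≤ r, its pointwise-log form, and
   `matchingModConstants_of_densities`: node U5's density statement ⇒ `MatchingModConstants`); Cauchy, convergence to
   `genFunLim`, the explicit tail bound, and UNIFORM convergence on the closed λ₀-ball; `cauchySum` assembles node U6
   in the shape node U0 consumes (`∀ t, |t| ≤ l₀ → CauchySeq (fun K ↦ genFun Z K t)`).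
§4 Where asymptotic freedom enters: Σ_{i<K} A/(i+1) ≤ A(1 + log K) (`harmonic_le_one_add_log`), hence
   ∏_{i<K}(1 + a·u_i) ≤ e^{aA}·K^{aA} when 0 ≤ u_i ≤ A/(i+1); and x^p ≤ x^{⌈p⌉₊} for x ≥ 1 (real to natural exponent,
   feeding `InjectedRate`'s `c : ℕ`).

Deliberately NOT here: any statement about propagators, minimizers, β-functions, effective actions, R-operations or
densities (nodes U1–U5 are estimate rows of the cell, each to be typed over the tree's Bałaban vocabulary by its own
row and then instantiated into §1); the step from Cauchy generating functions to `Missing.HasContinuumLimit` (node U0,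
row T4-U0.L); the Vitali/Montel step (node E3).  On the node text's "|G^A_K(λ) − G^B_{K+1}(λ)| ≤ δ_K|T₁|e^{2λ₀‖F‖}":
here U5's remainder bound is taken UNIFORM on |λ| ≤ λ₀ (the cell's dressed-stability hypothesis H2 has λ-uniform
constants), so the kernel factor is 2·vol (one remainder at λ, one at 0) and any e^{2λ₀‖F‖} is part of the constant
`E` of `delta` (cell DIVERGENCE D-pv26g2.1).  Mathlib only; no tree import is needed or used.
-/

namespace Literature.MathematicalPhysics.QuantumFieldTheory.Balaban1983to89.T4CauchySum

open Finset Filter Topology MeasureTheory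

/-! ## §1 Hypothesis shapes (predicates over abstract size sequences; never facts) -/

/-- HYPOTHESIS SHAPE (U1/U3-type η-rate; cell NE2, NE3, NE5): a scale-indexed sequence of discrepancy sizes decays
geometrically, `|s j| ≤ C θ^j` for every scale `j`.  For Bałaban's one-step linear objects and one-step outputs such an
η-difference bound is NOT in print (the printed bounds are uniform in the fine structure η, never differences in η);
the printed template of this shape is King's (3.9), d = 2, 3, U(1). [cite: King1986, Thm 3.4 (3.9) p. 656] -/
def GeomRate (C θ : ℝ) (s : ℕ → ℝ) : Prop :=
  ∀ j : ℕ, |s j| ≤ C * θ ^ j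

/-- HYPOTHESIS SHAPE (U1 + U2 + U3 combined; cell NE2–NE5): the total discrepancy injected at scale `j ≤ K` between
run A (K steps) and run B (K + 1 steps) is nonnegative and at most `C (K+1)^c θ^j` — geometric in the scale of
injection, with the polynomial factor `(K+1)^c` through which alone asymptotic freedom enters (node U2; §4).  Printed
template of the shape: King's (3.9). [cite: King1986, Thm 3.4 (3.9) p. 656] -/
def InjectedRate (C : ℝ) (c : ℕ) (θ : ℝ) (inj : ℕ → ℕ → ℝ) : Prop :=
  ∀ K j : ℕ, j ≤ K → 0 ≤ inj K j ∧ inj K j ≤ C * ((K : ℝ) + 1) ^ c * θ ^ j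

/-- TRANSPORTED TOTAL (U4 shape): a discrepancy `inj K j` injected at scale `j` is contracted by `ρ` per remaining
scale (`ρ = L^{−β}`, the printed irrelevance contraction `(L^{j−n})^β` of (2.43), read for differences of the two
runs' terms — cell NE6) and the contributions of all scales `j + n = K` are added with an overall constant `E`:
`delta E ρ inj K = E · Σ_{(j,n) ∈ antidiagonal K} inj K j · ρ^n`. [cite: Balaban1988Convergent, Thm 2 (2.43) p. 263] -/
noncomputable def delta (E ρ : ℝ) (inj : ℕ → ℕ → ℝ) (K : ℕ) : ℝ :=
  E * ∑ p ∈ antidiagonal K, inj K p.1 * ρ ^ p.2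

/-- HYPOTHESIS SHAPE (U5 output, cell NE7 — the d = 4 replacement of King's (3.10)–(3.13), NOT in print): the dressed
partition functions `Z K t` (run of K steps, source strength t; cell D2) of consecutive runs match MODULO CONSTANTS:
for every K there is a t-independent constant `c` with `|log Z_{K+1}(t) − log Z_K(t) − c| ≤ vol · δ K` for all
`|t| ≤ l₀`. [cite: King1986, (3.10)–(3.13) pp. 656–657] -/
def MatchingModConstants (vol l₀ : ℝ) (δ : ℕ → ℝ) (Z : ℕ → ℝ → ℝ) : Prop :=
  ∀ K : ℕ, ∃ c : ℝ, ∀ t : ℝ, |t| ≤ l₀ → |Real.log (Z (K + 1) t) - Real.log (Z K t) - c| ≤ vol * δ K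

/-- The generating function of the cell's D2: `genFun Z K t = log Z_K(t) − log Z_K(0)` (only t-DEPENDENT parts of
`log Z` survive; every field-independent constant quotients out). [folklore] -/
noncomputable def genFun (Z : ℕ → ℝ → ℝ) (K : ℕ) (t : ℝ) : ℝ :=
  Real.log (Z K t) - Real.log (Z K 0)

/-- The limit generating function `genFunLim Z t = lim_K genFun Z K t` (a `limUnder`; meaningful under the hypotheses
of `tendsto_genFun`). [folklore] -/
noncomputable def genFunLim (Z : ℕ → ℝ → ℝ) (t : ℝ) : ℝ :=
  limUnder atTop fun K => genFun Z K t

/-- A geometric rate with constant `C ≥ 0` and ratio `θ ≥ 0` persists under enlarging the ratio (used to pass from the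
individual rates θ_X of the five sources to θ⋆ = max θ_X). [folklore] -/
theorem GeomRate.mono {C θ θ' : ℝ} {s : ℕ → ℝ} (h : GeomRate C θ s) (hC : 0 ≤ C) (hθ : 0 ≤ θ) (hθ' : θ ≤ θ') :
    GeomRate C θ' s := fun j =>
  (h j).trans (mul_le_mul_of_nonneg_left (pow_le_pow_left₀ hθ hθ' j) hC)

/-- A K-independent geometric rate is an injected rate with any polynomial exponent `c` (since `1 ≤ (K+1)^c`).
[folklore] -/
theorem InjectedRate.of_geomRate {C θ : ℝ} {s : ℕ → ℕ → ℝ} (h : ∀ K, GeomRate C θ (s K)) (hC : 0 ≤ C)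
    (hθ : 0 ≤ θ) (c : ℕ) : InjectedRate C c θ (fun K j => |s K j|) := by
  intro K j _
  refine ⟨abs_nonneg _, (h K j).trans ?_⟩
  have h1 : (1 : ℝ) ≤ ((K : ℝ) + 1) ^ c := one_le_pow₀ (by linarith [(Nat.cast_nonneg K : (0 : ℝ) ≤ K)])
  calc C * θ ^ j = C * θ ^ j * 1 := (mul_one _).symm
    _ ≤ C * θ ^ j * ((K : ℝ) + 1) ^ c := mul_le_mul_of_nonneg_left h1 (mul_nonneg hC (pow_nonneg hθ _))
    _ = C * ((K : ℝ) + 1) ^ c * θ ^ j := by ring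

/-- Injected rates with the same ratio and exponent add (constants add). [folklore] -/
theorem InjectedRate.add {C₁ C₂ θ : ℝ} {c : ℕ} {a b : ℕ → ℕ → ℝ} (ha : InjectedRate C₁ c θ a)
    (hb : InjectedRate C₂ c θ b) : InjectedRate (C₁ + C₂) c θ (a + b) := by
  intro K j hj
  obtain ⟨ha0, ha1⟩ := ha K j hj
  obtain ⟨hb0, hb1⟩ := hb K j hj
  simp only [Pi.add_apply]
  refine ⟨add_nonneg ha0 hb0, ?_⟩
  have e : (C₁ + C₂) * ((K : ℝ) + 1) ^ c * θ ^ j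
      = C₁ * ((K : ℝ) + 1) ^ c * θ ^ j + C₂ * ((K : ℝ) + 1) ^ c * θ ^ j := by ring
  rw [e]
  exact add_le_add ha1 hb1

/-- An injected rate persists under enlarging the ratio. [folklore] -/
theorem InjectedRate.mono_rate {C θ θ' : ℝ} {c : ℕ} {a : ℕ → ℕ → ℝ} (h : InjectedRate C c θ a) (hC : 0 ≤ C)
    (hθ : 0 ≤ θ) (hθ' : θ ≤ θ') : InjectedRate C c θ' a := fun K j hj =>
  ⟨(h K j hj).1, (h K j hj).2.trans
    (mul_le_mul_of_nonneg_left (pow_le_pow_left₀ hθ hθ' j) (mul_nonneg hC (by positivity)))⟩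

/-- An injected rate forces `0 ≤ C (K+1)^c` (take `j = 0`). [folklore] -/
theorem InjectedRate.const_nonneg {C θ : ℝ} {c : ℕ} {inj : ℕ → ℕ → ℝ} (h : InjectedRate C c θ inj) (K : ℕ) :
    0 ≤ C * ((K : ℝ) + 1) ^ c := by
  have h0 := h K 0 (Nat.zero_le K)
  have : (0 : ℝ) ≤ C * ((K : ℝ) + 1) ^ c * θ ^ 0 := h0.1.trans h0.2
  simpa using this

/-! ## §2 The sum: convolution of a geometric rate with a geometric contraction, and its summability -/

/-- One term of the convolution: `θ^j ρ^n ≤ max(θ,ρ)^K` when `j + n = K`. [folklore] -/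
theorem pow_mul_pow_le_max_pow {θ ρ : ℝ} (hθ : 0 ≤ θ) (hρ : 0 ≤ ρ) {j n K : ℕ} (h : j + n = K) :
    θ ^ j * ρ ^ n ≤ (max θ ρ) ^ K := by
  subst h
  rw [pow_add]
  exact mul_le_mul (pow_le_pow_left₀ hθ (le_max_left _ _) _) (pow_le_pow_left₀ hρ (le_max_right _ _) _)
    (pow_nonneg hρ _) (pow_nonneg (hθ.trans (le_max_left _ _)) _)

/-- The convolution bound: `Σ_{j+n=K} θ^j ρ^n ≤ (K+1) · max(θ,ρ)^K`. [folklore] -/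
theorem sum_antidiagonal_pow_mul_pow_le {θ ρ : ℝ} (hθ : 0 ≤ θ) (hρ : 0 ≤ ρ) (K : ℕ) :
    ∑ p ∈ antidiagonal K, θ ^ p.1 * ρ ^ p.2 ≤ ((K : ℝ) + 1) * (max θ ρ) ^ K := by
  calc ∑ p ∈ antidiagonal K, θ ^ p.1 * ρ ^ p.2 ≤ ∑ p ∈ antidiagonal K, (max θ ρ) ^ K :=
        Finset.sum_le_sum fun p hp => pow_mul_pow_le_max_pow hθ hρ (mem_antidiagonal.mp hp)
    _ = ((K : ℝ) + 1) * (max θ ρ) ^ K := by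
        rw [Finset.sum_const, Finset.Nat.card_antidiagonal, nsmul_eq_mul]
        push_cast
        ring

/-- The transported total is nonnegative. [folklore] -/
theorem delta_nonneg {C θ E ρ : ℝ} {c : ℕ} {inj : ℕ → ℕ → ℝ} (hinj : InjectedRate C c θ inj) (hE : 0 ≤ E)
    (hρ : 0 ≤ ρ) (K : ℕ) : 0 ≤ delta E ρ inj K := by
  unfold delta
  refine mul_nonneg hE (Finset.sum_nonneg fun p hp => ?_)
  have hj : p.1 ≤ K := by have := mem_antidiagonal.mp hp; omega
  exact mul_nonneg (hinj K p.1 hj).1 (pow_nonneg hρ _)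

/-- **The Cauchy-sum estimate of node U6.**  Under an injected rate `C (K+1)^c θ^j` and contraction `ρ` per scale,
`delta E ρ inj K ≤ E · C · (K+1)^{c+1} · max(θ,ρ)^K`. [folklore] -/
theorem delta_le {C θ E ρ : ℝ} {c : ℕ} {inj : ℕ → ℕ → ℝ} (hinj : InjectedRate C c θ inj) (hE : 0 ≤ E)
    (hθ : 0 ≤ θ) (hρ : 0 ≤ ρ) (K : ℕ) :
    delta E ρ inj K ≤ E * C * ((K : ℝ) + 1) ^ (c + 1) * (max θ ρ) ^ K := by
  unfold delta
  have hsum : ∑ p ∈ antidiagonal K, inj K p.1 * ρ ^ p.2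
      ≤ ∑ p ∈ antidiagonal K, C * ((K : ℝ) + 1) ^ c * (θ ^ p.1 * ρ ^ p.2) := by
    refine Finset.sum_le_sum fun p hp => ?_
    have hj : p.1 ≤ K := by have := mem_antidiagonal.mp hp; omega
    calc inj K p.1 * ρ ^ p.2 ≤ (C * ((K : ℝ) + 1) ^ c * θ ^ p.1) * ρ ^ p.2 :=
          mul_le_mul_of_nonneg_right (hinj K p.1 hj).2 (pow_nonneg hρ _)
      _ = C * ((K : ℝ) + 1) ^ c * (θ ^ p.1 * ρ ^ p.2) := by ring
  have hC : 0 ≤ C * ((K : ℝ) + 1) ^ c := hinj.const_nonneg K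
  calc E * ∑ p ∈ antidiagonal K, inj K p.1 * ρ ^ p.2
      ≤ E * ∑ p ∈ antidiagonal K, C * ((K : ℝ) + 1) ^ c * (θ ^ p.1 * ρ ^ p.2) :=
        mul_le_mul_of_nonneg_left hsum hE
    _ = E * (C * ((K : ℝ) + 1) ^ c * ∑ p ∈ antidiagonal K, θ ^ p.1 * ρ ^ p.2) := by
        congr 1
        rw [Finset.mul_sum]
    _ ≤ E * (C * ((K : ℝ) + 1) ^ c * (((K : ℝ) + 1) * (max θ ρ) ^ K)) :=
        mul_le_mul_of_nonneg_left (mul_le_mul_of_nonneg_left (sum_antidiagonal_pow_mul_pow_le hθ hρ K) hC) hE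
    _ = E * C * ((K : ℝ) + 1) ^ (c + 1) * (max θ ρ) ^ K := by ring

/-- Polynomial times geometric is summable: `Σ_K (K+1)^k q^K < ∞` for `0 ≤ q < 1` (index-shifted form of Mathlib's
`summable_pow_mul_geometric_of_norm_lt_one`). [folklore] -/
theorem summable_succ_pow_mul_geometric {q : ℝ} (hq0 : 0 ≤ q) (hq1 : q < 1) (k : ℕ) :
    Summable (fun n : ℕ => ((n : ℝ) + 1) ^ k * q ^ n) := by
  rcases hq0.eq_or_lt with h | hq
  · subst h
    refine summable_of_ne_finset_zero (s := {0}) fun n hn => ?_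
    have hn : n ≠ 0 := by simpa using hn
    simp [zero_pow hn]
  · have hg : Summable (fun n : ℕ => (n : ℝ) ^ k * q ^ n) :=
      summable_pow_mul_geometric_of_norm_lt_one k (by rwa [Real.norm_eq_abs, abs_of_pos hq])
    have hq' : q ≠ 0 := hq.ne'
    have hg1 := ((summable_nat_add_iff 1).mpr hg).mul_right q⁻¹
    refine hg1.congr fun n => ?_
    push_cast
    rw [pow_succ]
    field_simp

/-- **Σ_K δ_K < ∞.**  Under an injected rate with ratio `θ ∈ [0,1[`, contraction `ρ ∈ [0,1[` and `E ≥ 0`, the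
transported totals are summable. [folklore] -/
theorem summable_delta {C θ E ρ : ℝ} {c : ℕ} {inj : ℕ → ℕ → ℝ} (hinj : InjectedRate C c θ inj) (hE : 0 ≤ E)
    (hθ : 0 ≤ θ) (hθ1 : θ < 1) (hρ : 0 ≤ ρ) (hρ1 : ρ < 1) : Summable (delta E ρ inj) := by
  have hq0 : 0 ≤ max θ ρ := hθ.trans (le_max_left θ ρ)
  have hq1 : max θ ρ < 1 := max_lt hθ1 hρ1
  refine Summable.of_nonneg_of_le (fun K => delta_nonneg hinj hE hρ K) (fun K => delta_le hinj hE hθ hρ K) ?_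
  have := (summable_succ_pow_mul_geometric hq0 hq1 (c + 1)).mul_left (E * C)
  simpa [mul_assoc] using this

/-! ## §3 Constants quotient out; Cauchy and uniform convergence of the generating functions -/

/-- Pointwise log-matching gives two-sided multiplicative bounds: for `a, b > 0`,
`|log b − log a − c| ≤ r ⇒ e^{c−r} a ≤ b ≤ e^{c+r} a`. [folklore] -/
theorem two_sided_of_abs_log_sub_le {a b c r : ℝ} (ha : 0 < a) (hb : 0 < b)
    (h : |Real.log b - Real.log a - c| ≤ r) : Real.exp (c - r) * a ≤ b ∧ b ≤ Real.exp (c + r) * a := by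
  rw [abs_le] at h
  constructor
  · rw [← Real.log_le_log_iff (mul_pos (Real.exp_pos _) ha) hb, Real.log_mul (Real.exp_pos _).ne' ha.ne',
      Real.log_exp]
    linarith [h.1]
  · rw [← Real.log_le_log_iff hb (mul_pos (Real.exp_pos _) ha), Real.log_mul (Real.exp_pos _).ne' ha.ne',
      Real.log_exp]
    linarith [h.2]

/-- **Constants quotient out under the integral** (cell D2, the pointwise-to-integral step between node U5's density
statement and `MatchingModConstants`): if `e^{c−r} f ≤ g ≤ e^{c+r} f` almost everywhere for integrable `f, g` with
`∫ f > 0`, then `|log ∫ g − log ∫ f − c| ≤ r`. [folklore] -/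
theorem abs_log_integral_sub_le {α : Type*} [MeasurableSpace α] {μ : Measure α} {f g : α → ℝ} {c r : ℝ}
    (hf : Integrable f μ) (hg : Integrable g μ) (hpos : 0 < ∫ x, f x ∂μ)
    (hlow : ∀ᵐ x ∂μ, Real.exp (c - r) * f x ≤ g x) (hupp : ∀ᵐ x ∂μ, g x ≤ Real.exp (c + r) * f x) :
    |Real.log (∫ x, g x ∂μ) - Real.log (∫ x, f x ∂μ) - c| ≤ r := by
  have h1 : Real.exp (c - r) * ∫ x, f x ∂μ ≤ ∫ x, g x ∂μ := by
    rw [← integral_const_mul]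
    exact integral_mono_ae (hf.const_mul _) hg hlow
  have h2 : ∫ x, g x ∂μ ≤ Real.exp (c + r) * ∫ x, f x ∂μ := by
    rw [← integral_const_mul]
    exact integral_mono_ae hg (hf.const_mul _) hupp
  have hgpos : 0 < ∫ x, g x ∂μ := lt_of_lt_of_le (mul_pos (Real.exp_pos _) hpos) h1
  rw [abs_le]
  constructor
  · have := Real.log_le_log (mul_pos (Real.exp_pos _) hpos) h1
    rw [Real.log_mul (Real.exp_pos _).ne' hpos.ne', Real.log_exp] at this
    linarith
  · have := Real.log_le_log hgpos h2
    rw [Real.log_mul (Real.exp_pos _).ne' hpos.ne', Real.log_exp] at this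
    linarith

/-- The same step from the POINTWISE LOG form of node U5: positive integrable densities with
`|log g(x) − log f(x) − c| ≤ r` for all `x` and `∫ f > 0` give `|log ∫ g − log ∫ f − c| ≤ r`. [folklore] -/
theorem abs_log_integral_sub_le_of_pointwise {α : Type*} [MeasurableSpace α] {μ : Measure α} {f g : α → ℝ}
    {c r : ℝ} (hf : Integrable f μ) (hg : Integrable g μ) (hpos : 0 < ∫ x, f x ∂μ)
    (hfpos : ∀ x, 0 < f x) (hgpos : ∀ x, 0 < g x) (h : ∀ x, |Real.log (g x) - Real.log (f x) - c| ≤ r) :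
    |Real.log (∫ x, g x ∂μ) - Real.log (∫ x, f x ∂μ) - c| ≤ r :=
  abs_log_integral_sub_le hf hg hpos
    (Eventually.of_forall fun x => (two_sided_of_abs_log_sub_le (hfpos x) (hgpos x) (h x)).1)
    (Eventually.of_forall fun x => (two_sided_of_abs_log_sub_le (hfpos x) (hgpos x) (h x)).2)

/-- **From node U5's DENSITY statement to `MatchingModConstants`.**  If the two runs' last-scale dressed densities
`ρ K t` and `ρ (K+1) t` (positive, integrable, on the same unit-lattice configuration space, with positive total
integrals) satisfy, for every K, `|log ρ_{K+1}^t(x) − log ρ_K^t(x) − c_K| ≤ vol·δ_K` for all configurations `x` and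
all `|t| ≤ l₀` with a constant `c_K` independent of `(t, x)`, then their partition functions `Z K t = ∫ ρ K t` match
modulo constants with the same remainders.  (The node's "c_K may diverge with K — it quotients out".) [folklore] -/
theorem matchingModConstants_of_densities {α : Type*} [MeasurableSpace α] (μ : Measure α) {vol l₀ : ℝ}
    {δ : ℕ → ℝ} (ρ : ℕ → ℝ → α → ℝ) (hint : ∀ K t, |t| ≤ l₀ → Integrable (ρ K t) μ)
    (hpos : ∀ K t x, 0 < ρ K t x) (hZ : ∀ K t, |t| ≤ l₀ → 0 < ∫ x, ρ K t x ∂μ)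
    (h : ∀ K : ℕ, ∃ c : ℝ, ∀ t : ℝ, |t| ≤ l₀ → ∀ x, |Real.log (ρ (K + 1) t x) - Real.log (ρ K t x) - c| ≤ vol * δ K) :
    MatchingModConstants vol l₀ δ (fun K t => ∫ x, ρ K t x ∂μ) := by
  intro K
  obtain ⟨c, hc⟩ := h K
  exact ⟨c, fun t ht => abs_log_integral_sub_le_of_pointwise (hint K t ht) (hint (K + 1) t ht) (hZ K t ht)
    (hpos K t) (hpos (K + 1) t) (hc t ht)⟩

/-- **The Cauchy bound on the generating functions**: under `MatchingModConstants vol l₀ δ Z` (and `0 ≤ l₀`, so that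
`t = 0` is admissible), `|genFun Z (K+1) t − genFun Z K t| ≤ 2·(vol·δ K)` for `|t| ≤ l₀` — the constant `c_K` cancels
between `t` and `0`. [folklore] -/
theorem abs_genFun_succ_sub_le {vol l₀ : ℝ} {δ : ℕ → ℝ} {Z : ℕ → ℝ → ℝ} (h : MatchingModConstants vol l₀ δ Z)
    (hl₀ : 0 ≤ l₀) (K : ℕ) {t : ℝ} (ht : |t| ≤ l₀) :
    |genFun Z (K + 1) t - genFun Z K t| ≤ 2 * (vol * δ K) := by
  obtain ⟨cK, hc⟩ := h K
  have h1 := hc t ht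
  have h0 := hc 0 (by simpa using hl₀)
  unfold genFun
  have e : Real.log (Z (K + 1) t) - Real.log (Z (K + 1) 0) - (Real.log (Z K t) - Real.log (Z K 0))
      = (Real.log (Z (K + 1) t) - Real.log (Z K t) - cK) - (Real.log (Z (K + 1) 0) - Real.log (Z K 0) - cK) := by
    ring
  rw [e]
  have tri := abs_sub_le (Real.log (Z (K + 1) t) - Real.log (Z K t) - cK) 0
    (Real.log (Z (K + 1) 0) - Real.log (Z K 0) - cK)
  simp only [sub_zero, zero_sub, abs_neg] at tri
  linarith

/-- Each generating function sequence `K ↦ genFun Z K t`, `|t| ≤ l₀`, is CAUCHY when the matching remainders are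
summable. [folklore] -/
theorem cauchySeq_genFun {vol l₀ : ℝ} {δ : ℕ → ℝ} {Z : ℕ → ℝ → ℝ} (h : MatchingModConstants vol l₀ δ Z)
    (hl₀ : 0 ≤ l₀) (hδ : Summable δ) {t : ℝ} (ht : |t| ≤ l₀) : CauchySeq fun K => genFun Z K t := by
  refine cauchySeq_of_dist_le_of_summable (fun K => 2 * (vol * δ K)) (fun K => ?_)
    ((hδ.mul_left vol).mul_left 2)
  rw [Real.dist_eq, abs_sub_comm]
  exact abs_genFun_succ_sub_le h hl₀ K ht

/-- … hence CONVERGENT, to `genFunLim Z t`. [folklore] -/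
theorem tendsto_genFun {vol l₀ : ℝ} {δ : ℕ → ℝ} {Z : ℕ → ℝ → ℝ} (h : MatchingModConstants vol l₀ δ Z)
    (hl₀ : 0 ≤ l₀) (hδ : Summable δ) {t : ℝ} (ht : |t| ≤ l₀) :
    Tendsto (fun K => genFun Z K t) atTop (𝓝 (genFunLim Z t)) :=
  (cauchySeq_genFun h hl₀ hδ ht).tendsto_limUnder

/-- Explicit TAIL BOUND, uniform in `t`: `|genFun Z K t − genFunLim Z t| ≤ Σ_{m} 2·vol·δ (K+m)`. [folklore] -/
theorem abs_genFun_sub_lim_le {vol l₀ : ℝ} {δ : ℕ → ℝ} {Z : ℕ → ℝ → ℝ} (h : MatchingModConstants vol l₀ δ Z)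
    (hl₀ : 0 ≤ l₀) (hδ : Summable δ) {t : ℝ} (ht : |t| ≤ l₀) (K : ℕ) :
    |genFun Z K t - genFunLim Z t| ≤ ∑' m, 2 * (vol * δ (K + m)) := by
  have := dist_le_tsum_of_dist_le_of_tendsto (fun K => 2 * (vol * δ K))
    (fun K => by rw [Real.dist_eq, abs_sub_comm]; exact abs_genFun_succ_sub_le h hl₀ K ht)
    ((hδ.mul_left vol).mul_left 2) (tendsto_genFun h hl₀ hδ ht) K
  rwa [Real.dist_eq] at this

/-- UNIFORM convergence on the closed l₀-ball (the remainders do not depend on `t`). [folklore] -/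
theorem tendstoUniformlyOn_genFun {vol l₀ : ℝ} {δ : ℕ → ℝ} {Z : ℕ → ℝ → ℝ} (h : MatchingModConstants vol l₀ δ Z)
    (hl₀ : 0 ≤ l₀) (hδ : Summable δ) :
    TendstoUniformlyOn (fun K t => genFun Z K t) (genFunLim Z) atTop {t | |t| ≤ l₀} := by
  rw [Metric.tendstoUniformlyOn_iff]
  intro ε hε
  have htail : Tendsto (fun K : ℕ => ∑' m, 2 * (vol * δ (K + m))) atTop (𝓝 0) := by
    have e : (fun K : ℕ => ∑' m, 2 * (vol * δ (K + m))) = fun K : ℕ => ∑' m, 2 * (vol * δ (m + K)) := by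
      funext K
      congr 1
      funext m
      rw [add_comm]
    rw [e]
    exact tendsto_sum_nat_add fun n => 2 * (vol * δ n)
  filter_upwards [htail.eventually (gt_mem_nhds hε)] with K hK t ht
  rw [dist_comm, Real.dist_eq]
  exact (abs_genFun_sub_lim_le h hl₀ hδ ht K).trans_lt hK

/-- **Node U6 (THE CAUCHY SUM), assembled.**  From nodes U1–U4 as the named size hypotheses `InjectedRate C c θ inj`
(θ ∈ [0,1[: the η-rates; `(K+1)^c`: asymptotic freedom), contraction `ρ ∈ [0,1[` per scale (ρ = L^{−β}), and node U5
as `MatchingModConstants vol l₀ (delta E ρ inj) Z`: the transported totals δ_K are summable, consecutive generating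
functions differ by at most `2·vol·δ_K` on `|t| ≤ l₀`, every `K ↦ genFun Z K t` is Cauchy, and the convergence to
`genFunLim Z` is uniform on the closed l₀-ball — the input node U0 consumes.  A CONDITIONAL kernel theorem: none of
its hypotheses is in print for Bałaban's d = 4 procedure (cell NE2–NE7). [folklore] -/
theorem cauchySum {C θ ρ E vol l₀ : ℝ} {c : ℕ} {inj : ℕ → ℕ → ℝ} {Z : ℕ → ℝ → ℝ}
    (hinj : InjectedRate C c θ inj) (hθ : 0 ≤ θ) (hθ1 : θ < 1) (hρ : 0 ≤ ρ) (hρ1 : ρ < 1) (hE : 0 ≤ E)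
    (hl₀ : 0 ≤ l₀) (hU5 : MatchingModConstants vol l₀ (delta E ρ inj) Z) :
    Summable (delta E ρ inj) ∧
    (∀ K : ℕ, ∀ t : ℝ, |t| ≤ l₀ → |genFun Z (K + 1) t - genFun Z K t| ≤ 2 * (vol * delta E ρ inj K)) ∧
    (∀ t : ℝ, |t| ≤ l₀ → CauchySeq fun K => genFun Z K t) ∧
    TendstoUniformlyOn (fun K t => genFun Z K t) (genFunLim Z) atTop {t | |t| ≤ l₀} := by
  have hδ : Summable (delta E ρ inj) := summable_delta hinj hE hθ hθ1 hρ hρ1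
  exact ⟨hδ, fun K t ht => abs_genFun_succ_sub_le hU5 hl₀ K ht, fun t ht => cauchySeq_genFun hU5 hl₀ hδ ht,
    tendstoUniformlyOn_genFun hU5 hl₀ hδ⟩

/-! ## §4 Where asymptotic freedom enters: the logarithmic sum of squared couplings -/

/-- Harmonic comparison: `Σ_{i<K} A/(i+1) ≤ A·(1 + log K)` for `A ≥ 0` (Mathlib `harmonic_le_one_add_log`; at `K = 0`
both sides read `0 ≤ A`). [folklore] -/
theorem sum_range_div_succ_le {A : ℝ} (hA : 0 ≤ A) (K : ℕ) :
    ∑ i ∈ Finset.range K, A / ((i : ℝ) + 1) ≤ A * (1 + Real.log K) := by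
  have h := harmonic_le_one_add_log K
  have e : ((harmonic K : ℚ) : ℝ) = ∑ i ∈ Finset.range K, ((i : ℝ) + 1)⁻¹ := by
    push_cast [harmonic]
    rfl
  rw [e] at h
  calc ∑ i ∈ Finset.range K, A / ((i : ℝ) + 1) = A * ∑ i ∈ Finset.range K, ((i : ℝ) + 1)⁻¹ := by
        rw [Finset.mul_sum]
        refine Finset.sum_congr rfl fun i _ => ?_
        rw [div_eq_mul_inv]
    _ ≤ A * (1 + Real.log K) := mul_le_mul_of_nonneg_left h hA

/-- **Where asymptotic freedom enters node U6** (cell T4-DAG U2/U6): if the squared couplings seen backwards from the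
infrared end obey `0 ≤ u_i ≤ A/(i+1)` (the shape of the printed running bound, Σ_{i<K} g_i² = O(log K)), then the
product of the one-step Lipschitz factors is POLYNOMIAL in the number of steps:
`∏_{i<K} (1 + a·u_i) ≤ e^{aA} · K^{aA}` for `K ≥ 1`, `a, A ≥ 0`. [folklore] -/
theorem prod_one_add_mul_le_exp_mul_rpow {a A : ℝ} (ha : 0 ≤ a) (hA : 0 ≤ A) {u : ℕ → ℝ} (hu0 : ∀ i, 0 ≤ u i)
    (hu : ∀ i, u i ≤ A / ((i : ℝ) + 1)) {K : ℕ} (hK : 1 ≤ K) :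
    ∏ i ∈ Finset.range K, (1 + a * u i) ≤ Real.exp (a * A) * (K : ℝ) ^ (a * A) := by
  have h1 : ∏ i ∈ Finset.range K, (1 + a * u i) ≤ Real.exp (∑ i ∈ Finset.range K, a * u i) :=
    Real.prod_one_add_le_exp_sum _ fun i => mul_nonneg ha (hu0 i)
  have h2 : ∑ i ∈ Finset.range K, a * u i ≤ a * (A * (1 + Real.log K)) := by
    rw [← Finset.mul_sum]
    refine mul_le_mul_of_nonneg_left ?_ ha
    calc ∑ i ∈ Finset.range K, u i ≤ ∑ i ∈ Finset.range K, A / ((i : ℝ) + 1) :=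
          Finset.sum_le_sum fun i _ => hu i
      _ ≤ A * (1 + Real.log K) := sum_range_div_succ_le hA K
  have hKpos : (0 : ℝ) < K := by exact_mod_cast hK
  calc ∏ i ∈ Finset.range K, (1 + a * u i) ≤ Real.exp (∑ i ∈ Finset.range K, a * u i) := h1
    _ ≤ Real.exp (a * (A * (1 + Real.log K))) := Real.exp_le_exp.mpr h2
    _ = Real.exp (a * A) * (K : ℝ) ^ (a * A) := by
        rw [Real.rpow_def_of_pos hKpos, ← Real.exp_add]
        congr 1
        ring

/-- Real to natural exponent: `x^p ≤ x^{⌈p⌉₊}` for `x ≥ 1` — so a polynomial factor `K^{aA}` with real exponent is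
dominated by `(K+1)^c` with `c = ⌈aA⌉₊ : ℕ`, the form `InjectedRate` takes. [folklore] -/
theorem rpow_le_pow_natCeil {x p : ℝ} (hx : 1 ≤ x) : x ^ p ≤ x ^ (⌈p⌉₊ : ℕ) := by
  calc x ^ p ≤ x ^ ((⌈p⌉₊ : ℕ) : ℝ) := Real.rpow_le_rpow_of_exponent_le hx (Nat.le_ceil p)
    _ = x ^ (⌈p⌉₊ : ℕ) := Real.rpow_natCast x _

end Literature.MathematicalPhysics.QuantumFieldTheory.Balaban1983to89.T4CauchySum
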